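import Summits.HodgeConjecture.HodgeConjecture.Theorems.R90S6HeckeCoeffIndepInert     -- ★ W9-A (A.2) `coeff_toVector_comp_eq_of_memLaw_inert` (this seat)
import Mathlib.NumberTheory.NumberField.CMField
import HarnessLib

/-!
# R90 · S6 «Ch. 14.1–14.5 stable trace formula» — WAVE 9-A card (A.3): «eG-INDEPENDENCE», THE CM SOCKET DRESS
# (`Theorems/R90S6HeckeCoeffIndepCM.lean`)

Cell `hodgecm-mathlib`, crux H413 (`stmt-HodgeConjecture-24833`), route of record `HCCMUnconditional`; programme R90-TF, section S6 (base `R90-C14`), seat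
R90-C14-p07 (g0); S6 dealer R90-C14-plan (g2) DEAL W9-A (R90 bus l.5391 ∕ l.5467, reminder 2026-09-05T00:01:35Z); AUDIT BOX S6#W9-A SHEET CLEAN (l.5385).
Statement VERBATIM from the typist's sheet `R90/R90-C14-typ1/g2/S6_wave9A_targets.v1.db09522d8f01f282.lean` :168–:186 (namespace `…R90.S6`, the sheet's `.Wave9A`
dropped).  Lane `--kind proof --supports stmt-HodgeConjecture-24833 --as helper`; ONE public theorem; no definition, no instance, no notation, no named fact, no `sorry`;
imports = ★ `Theorems/R90S6HeckeCoeffIndepInert` (A.2) + Mathlib `NumberTheory.NumberField.CMField` + HarnessLib (no Lines import).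

THE MATHEMATICS.  `L` a CM field with complex conjugation `c = IsCMField.complexConj L ∈ Gal(L ∕ L⁺)`, `L⁺ = maximalRealSubfield L`, `w ∣ v` an INERT (`c • w = w`)
UNRAMIFIED (`v` unramified in `L`) finite place, `U_w = U(σ_w, J₀)(L_w)`, `K₀ = unitaryInt` its hyperspecial subgroup.  For any topological group `Gv` with a subgroup `Kv`
and any two topological-group isomorphisms `eG eG' : Gv ≃ₜ* U_w` with the K-law `eG g ∈ K₀ ↔ g ∈ Kv` (both), every `f ∈ ℋ(U_w, K₀)` over `ℂ` is read as the SAME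
function `g ↦ (f [K₀])((eG g) K₀)` on `Gv` — this is S6-D's `heckeToFun K₀ f (eG g)` by `rfl` (`Cruxes/H413/Lines/R90_S6_FloorE1D.lean` :219), in exactly the token shape of
the `eG` ∕ K-law binders of the sockets `StubR90ExtE1HeckeFL` (D :301–:303) and `StubR90ExtE1TwistedTransferFL` conjunct 2 (D :519–:523).  PROOF = (A.2)
`coeff_toVector_comp_eq_of_memLaw_inert` at `F := ↥(maximalRealSubfield L)`, `E := L`, `c := IsCMField.complexConj L`, `hc :=` Mathlib `IsCMField.complexConj_ne_one L`,
`haveI := IsCMField.isQuadraticExtension L`, `e := eG.toMulEquiv`, `e' := eG'.toMulEquiv` (typ1's composition cert `scratch_W9A_compose.lean` 0d58f7e4dceb6619, `A3_of`).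
CONSEQUENCE for the E1.3.9 ∕ E1.4.4.5a assemblies (typ2's D ED. 4 `heckeCoeffFrameIndepCM_holds`): prove the Hecke ∕ twisted-transfer FL for ONE framed transport `e₀` with
the K-law (row E1.3.3.4) and obtain it for every `eG` — no Borel–Tits rigidity.
HONEST LABEL: helper theorem, count-neutral until D ED. 4 ∕ E1.3.9 consume it; proves no printed statement by itself.  HC_CM is proved only modulo the 7 printed citations
(2 remaining named inputs: hLiu418 = stmt-HodgeConjecture-24832, h413 = stmt-HodgeConjecture-24833) until rung 0 closes.

## References
* [CartierCorvallis1979] P. Cartier, *Representations of 𝔭-adic groups: a survey*, PSPM 33.1 (1979), §IV.1.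
* [Rogawski1990] J. D. Rogawski, *Automorphic Representations of Unitary Groups in Three Variables*, Ann. of Math. Stud. 123 (1990), §4.9 p. 55, §4.10 Prop. 4.10.1.
* [BruhatTits1972] F. Bruhat, J. Tits, *Groupes réductifs sur un corps local I*, Publ. Math. IHÉS 41 (1972), (4.4.3)–(4.4.4).
-/
set_option autoImplicit false
-- the mandated namespace repeats the single-problem summit's segment (`HodgeConjecture.HodgeConjecture`)
set_option linter.dupNamespace false

noncomputable section

open scoped Valued WithZero Matrix MatrixGroups

open MulAction MonoidAlgebra
open Literature.NumberTheory.Automorphic Literature.NumberTheory.Automorphic.HermitianLattice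
  Literature.NumberTheory.Automorphic.UnitaryLatticeTree

namespace Summit.HodgeConjecture.HodgeConjecture.R90.S6

section CM

open _root_.NumberField _root_.IsDedekindDomain Literature.NumberTheory.Automorphic.UnitaryGroup

/-- **W9-A.3 «eG-independence», THE CM SOCKET DRESS** (the decl the E1.3.9 ∕ E1.4.4.5a assemblies consume): at an inert (`hw`) unramified (`hv`) place `w ∣ v` of the CM
field `L`, any two topological-group isomorphisms `eG eG' : Gv ≃ₜ* U(σ_w, J₀)(L_w)` with the K-law `eG g ∈ K₀ ↔ g ∈ Kv` read every `f ∈ ℋ(U_w, K₀)` (over `ℂ`) as the same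
function `g ↦ (f [K₀])((eG g) K₀)` = D's `heckeToFun K₀ f (eG g)` (`rfl`).  Proof: (A.2) `coeff_toVector_comp_eq_of_memLaw_inert` at `F := ↥(maximalRealSubfield L)`,
`c := IsCMField.complexConj L`, `hc := IsCMField.complexConj_ne_one L`, `haveI := IsCMField.isQuadraticExtension L`, `e := eG.toMulEquiv`, `e' := eG'.toMulEquiv`.
(Sheet `S6_wave9A_targets.v1.db09522d8f01f282.lean` :168 verbatim.) [cite: CartierCorvallis1979, §IV.1] [cite: Rogawski1990, §4.10 Prop. 4.10.1] -/
theorem coeff_toVector_comp_eq_of_memLaw_cm (L : Type) [Field L] [NumberField L] [IsCMField L]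
    {v : HeightOneSpectrum (𝓞 ↥(maximalRealSubfield L))} (w : UnitaryGroup.PlacesOver L v) (hw : IsCMField.complexConj L • w.1 = w.1)
    (hv : Algebra.IsUnramifiedIn (𝓞 L) v.asIdeal)
    {Gv : Type*} [Group Gv] [TopologicalSpace Gv] (Kv : Subgroup Gv)
    (eG eG' : Gv ≃ₜ* ↥(unitaryGroupOfForm (galAdicCompletionMap (L := L) (IsCMField.complexConj L) hw) ((StdForm.antidiagonal 3).over (w.1.adicCompletion L))))
    (heG : ∀ g : Gv,
      eG g ∈ unitaryInt (galAdicCompletionMap (L := L) (IsCMField.complexConj L) hw) ((StdForm.antidiagonal 3).over (w.1.adicCompletion L)) ↔ g ∈ Kv)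
    (heG' : ∀ g : Gv,
      eG' g ∈ unitaryInt (galAdicCompletionMap (L := L) (IsCMField.complexConj L) hw) ((StdForm.antidiagonal 3).over (w.1.adicCompletion L)) ↔ g ∈ Kv)
    (f : heckeAlgebra ℂ ↥(unitaryGroupOfForm (galAdicCompletionMap (L := L) (IsCMField.complexConj L) hw) ((StdForm.antidiagonal 3).over (w.1.adicCompletion L)))
      (unitaryInt (galAdicCompletionMap (L := L) (IsCMField.complexConj L) hw) ((StdForm.antidiagonal 3).over (w.1.adicCompletion L)))) :
    (fun g : Gv => (heckeAlgebra.toVector (unitaryInt (galAdicCompletionMap (L := L) (IsCMField.complexConj L) hw) ((StdForm.antidiagonal 3).over (w.1.adicCompletion L))) f).coeff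
        ((eG' g : ↥(unitaryGroupOfForm (galAdicCompletionMap (L := L) (IsCMField.complexConj L) hw) ((StdForm.antidiagonal 3).over (w.1.adicCompletion L)))) :
          ↥(unitaryGroupOfForm (galAdicCompletionMap (L := L) (IsCMField.complexConj L) hw) ((StdForm.antidiagonal 3).over (w.1.adicCompletion L))) ⧸
            unitaryInt (galAdicCompletionMap (L := L) (IsCMField.complexConj L) hw) ((StdForm.antidiagonal 3).over (w.1.adicCompletion L)))) =
      fun g : Gv => (heckeAlgebra.toVector (unitaryInt (galAdicCompletionMap (L := L) (IsCMField.complexConj L) hw) ((StdForm.antidiagonal 3).over (w.1.adicCompletion L))) f).coeff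
        ((eG g : ↥(unitaryGroupOfForm (galAdicCompletionMap (L := L) (IsCMField.complexConj L) hw) ((StdForm.antidiagonal 3).over (w.1.adicCompletion L)))) :
          ↥(unitaryGroupOfForm (galAdicCompletionMap (L := L) (IsCMField.complexConj L) hw) ((StdForm.antidiagonal 3).over (w.1.adicCompletion L))) ⧸
            unitaryInt (galAdicCompletionMap (L := L) (IsCMField.complexConj L) hw) ((StdForm.antidiagonal 3).over (w.1.adicCompletion L))) := by
  haveI : Algebra.IsQuadraticExtension ↥(maximalRealSubfield L) L := IsCMField.isQuadraticExtension L
  exact coeff_toVector_comp_eq_of_memLaw_inert (IsCMField.complexConj L) v (IsCMField.complexConj_ne_one L) hv w hw Kv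
    eG.toMulEquiv eG'.toMulEquiv heG heG' f

end CM

end Summit.HodgeConjecture.HodgeConjecture.R90.S6

end
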